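import Literature.Computability.Complexity.TrimAnswers
import Literature.Computability.Complexity.LazySamplingOracle
import Literature.Computability.Complexity.OracleClockFst
import Literature.Computability.Complexity.OracleCompositionMachine
import Literature.Computability.Complexity.OracleEmpty
import HarnessLib

/-!
# Bennett–Gill's coin-flip simulator is polynomial time (the lazy-sampling language is in `P`)

The machine half of Bennett–Gill's `ALMOST-P ⊆ BPP` (Book–Vollmer–Wagner 1996, §3 Prop. 1–2:
the type-2 operator `BP²` over `P` is a classical `BP` operator over coin words), over G01's
transcript model. For a polynomial-time oracle machine `M` with polynomially bounded queries, a
finite table `τ` on `F` and a round budget `q`, the **lazy-sampling language**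
`lazyLang M F τ q = {⟨x, y⟩ | runWith M x (coinAns M F τ x y) (q |x|) [] = some true}`
(`LazySampling.lean`: queries in `F` answered by `τ`, repeated queries by their earlier answer,
fresh queries by fresh coins of `y`) is in `P` (`lazyLang_mem_P`). No Turing machine is
programmed; the simulator is assembled from the tree's oracle-machine combinators:

* `lazySim M = ((M.trimAnswers).comap fstF).mapQuery id` — run `M` (reading only the first
  symbol of each answer, `TrimAnswers.lean`) on the first component `x` of the input `w = ⟨x, y⟩`
  (`OracleAlg.comap`), announcing with each query `u` the record `⟨w, ⟨code E, u⟩⟩` of the input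
  and the whole transcript `E` (`OracleAlg.mapQuery`); its oracle is the `FP` function
  `lazyOracle F τ` of `LazySamplingOracle.lean`, which answers `bit :: u` — table, else cache
  (found in the echoed transcript), else coin. **Semantics** (`runAux_lazySim`, `run_lazySim`):
  along the run the transcript is the *echo transcript* `echo M x as` of the bit transcript `as`
  of `runWith` (item `i` = bit of round `i` followed by the query of round `i`), on which the
  oracle's bit is exactly the lazy-sampling rule (`lazyBit_echo`), so the simulator's run is
  `runWith M x (coinAns M F τ x y)`.
* `lazySimC M q = (lazySim M).clockFst q false` — clocked by `q(|x|)` (`OracleClockFst.lean`), so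
  that it outputs against every oracle; with the polynomial `simPoly c q` bounding rounds and
  query sizes (`length_query_lazySim`: a query record has size `≤ 2|w| + K + 6 + 12m + 4mK` for
  `m` rounds and queries of `M` of length `≤ K`), `lazyLang M F τ q ∈ PRel (lazyOracle F τ)`
  (`lazyLang_mem_PRel`).
* Composition: `lazyOracle F τ ∈ FP ⊆ FP^∅`, `P^{FP^∅} ⊆ P^∅ = P`
  (`OracleAlg.PRel_subset_PRel_of_mem_FPRel`, `PRel_empty_holds`): `lazyLang_mem_P`.

This is the statement `Literature.Computability.Complexity.LazySamplingSimulatorInP` of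
`AlmostPProofs.lean`, which assembles `almostP_subset_BPP_holds` from it.

## References

* C. H. Bennett, J. Gill, SIAM J. Comput. 10 (1981) 96–113 [BennettGill1981].
* R. V. Book, H. Vollmer, K. W. Wagner, ICALP 1996, LNCS 1099 [BookVollmerWagner1996], §3
  Prop. 1–2 (p. 373–374), §4 Thm. 3 (p. 374).
* S. Arora, B. Barak, *Computational Complexity: A Modern Approach*, CUP 2009, §3.4 (oracle
  machines), §1.3–1.4 (composition, clocked simulation).
-/

namespace Literature.Computability.Complexity

open _root_.Computability Brick LazySim

namespace OracleAlg

variable (M : OracleAlg Bool) (x : List Bool)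

/-! ### The echo transcript -/

/-- The echo transcript of a bit transcript `as`: item `i` is the bit of `as[i]` followed by the
query `M` asks at round `i` (junk `ε` if it outputs there). [folklore] -/
def echo (as : List (List Bool)) : List (List Bool) :=
  (List.range as.length).map fun i => (as[i]?.getD []).headD false :: (queryAt M x as i).getD []

/-- The echo transcript has one item per round. [folklore] -/
theorem length_echo (as : List (List Bool)) : (echo M x as).length = as.length := by simp [echo]

/-- The query at an earlier round does not depend on later answers. [folklore] -/
theorem queryAt_append_of_lt {as bs : List (List Bool)} {i : ℕ} (hi : i ≤ as.length) :
    queryAt M x (as ++ bs) i = queryAt M x as i := by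
  unfold queryAt; rw [List.take_append_of_le_length hi]

/-- One more answered round appends one echo item. [folklore] -/
theorem echo_append_singleton {as : List (List Bool)} {u : List Bool} (c : Bool)
    (hstep : M.step x as = Sum.inl u) : echo M x (as ++ [[c]]) = echo M x as ++ [c :: u] := by
  unfold echo
  rw [List.length_append, List.length_singleton, List.range_succ, List.map_append, List.map_singleton]
  congr 1
  · refine List.map_congr_left fun i hi => ?_
    rw [List.mem_range] at hi
    rw [List.getElem?_append_left hi, queryAt_append_of_lt M x hi.le]
  · have hq : queryAt M x (as ++ [[c]]) as.length = some u := by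
      unfold queryAt; rw [List.take_left' rfl, hstep]
    simp [hq]

/-- The first symbols of the echo transcript of a transcript of single bits are those bits. [folklore] -/
theorem map_take_one_echo {as : List (List Bool)} (hbits : ∀ a ∈ as, ∃ c : Bool, a = [c]) :
    (echo M x as).map (List.take 1) = as := by
  apply List.ext_getElem
  · simp [echo]
  · intro i h1 h2
    obtain ⟨c, hc⟩ := hbits _ (List.getElem_mem h2)
    simp [echo, List.getElem?_eq_getElem h2, hc]

/-- **The lazy oracle's bit on the echo transcript is the lazy-sampling rule** `coinAns`
(along transcripts all of whose rounds queried: the first earlier item with the same query is the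
first earlier round that asked it, `cachedAnswer`). [cite: BookVollmerWagner1996, §3 Prop. 1–2 (p. 373–374)] -/
theorem lazyBit_echo (F : Finset (List Bool)) (τ : F → Bool) (y : List Bool) {as : List (List Bool)}
    (hwf : ∀ i < as.length, ∃ u, queryAt M x as i = some u) (u : List Bool) :
    lazyBit F τ y (echo M x as) u = coinAns M F τ x y as u := by
  unfold lazyBit coinAns
  by_cases hu : u ∈ F
  · rw [dif_pos hu, dif_pos hu]
  rw [dif_neg hu, dif_neg hu, length_echo]
  -- the first hit in the echo transcript is the cached answer
  have hfc : ∀ (l : List ℕ) (p q : ℕ → Bool), (∀ a ∈ l, p a = q a) → l.find? p = l.find? q := by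
    intro l p q h
    induction l with
    | nil => rfl
    | cons a l ih =>
      rw [List.find?_cons, List.find?_cons, h a (by simp), ih fun b hb => h b (by simp [hb])]
  have hfind : (echo M x as).find? (fun e => !e.isEmpty && decide (e.tail = u)) =
      ((List.range as.length).find? fun i => queryAt M x as i = some u).map
        fun i => (as[i]?.getD []).headD false :: (queryAt M x as i).getD [] := by
    unfold echo
    rw [List.find?_map]
    congr 1
    refine hfc _ _ _ fun i hi => ?_
    rw [List.mem_range] at hi
    obtain ⟨u', hu'⟩ := hwf i hi
    simp [Function.comp_apply, hu']
  unfold firstHit cachedAnswer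
  rw [hfind]
  cases hf : (List.range as.length).find? (fun i => queryAt M x as i = some u) with
  | none => simp
  | some i => simp

/-! ### The simulator -/

/-- **The (unclocked) simulator**: `M` reading first symbols, run on the first component of its
input, announcing input and transcript with each query. [cite: BookVollmerWagner1996, §3 Prop. 1–2 (p. 373–374)] -/
noncomputable def lazySim : OracleAlg Bool := (M.trimAnswers.comap fstF).mapQuery id

/-- The step of the simulator. [folklore] -/
theorem lazySim_step (w : List Bool) (E : List (List Bool)) :
    (lazySim M).step w E = (match M.step (fstF w) (E.map (List.take 1)) with
      | Sum.inl u => Sum.inl (boolPair w (boolPair ((encodingList Bool).listBool.encode E) u))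
      | Sum.inr b => Sum.inr b) := by
  unfold lazySim
  rw [mapQuery_step, comap_step, trimAnswers_step]
  cases M.step (fstF w) (E.map (List.take 1)) <;> rfl

/-- **Semantics of the simulator**: against the lazy oracle, from the echo transcript of a bit
transcript `as` all of whose rounds queried, the simulator runs as `runWith` under the
lazy-sampling rule from `as`. [folklore] -/
theorem runAux_lazySim (F : Finset (List Bool)) (τ : F → Bool) (w : List Bool) :
    ∀ (n : ℕ) (as : List (List Bool)), (∀ a ∈ as, ∃ c : Bool, a = [c]) →
      (∀ i < as.length, ∃ u, queryAt M (fstF w) as i = some u) →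
      (lazySim M).runAux (lazyOracle F τ) w n (echo M (fstF w) as) =
        runWith M (fstF w) (coinAns M F τ (fstF w) (sndF w)) n as
  | 0, _, _, _ => rfl
  | n + 1, as, hbits, hwf => by
    rw [runAux_succ, lazySim_step, map_take_one_echo M _ hbits, runWith]
    cases hs : M.step (fstF w) as with
    | inr b => rfl
    | inl u =>
      dsimp only
      rw [lazyOracle_apply, lazyBit_echo M _ F τ _ hwf, ← echo_append_singleton M _ _ hs]
      refine runAux_lazySim F τ w n _ (fun a ha => ?_) (fun i hi => ?_)
      · rcases List.mem_append.1 ha with h | h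
        · exact hbits a h
        · simp at h; exact ⟨_, h⟩
      · rw [List.length_append, List.length_singleton] at hi
        rcases Nat.lt_succ_iff_lt_or_eq.1 hi with hi | rfl
        · obtain ⟨u', hu'⟩ := hwf i hi
          exact ⟨u', by rw [queryAt_append_of_lt M _ hi.le, hu']⟩
        · exact ⟨u, by unfold queryAt; rw [List.take_left' rfl, hs]⟩

/-- **The simulator's run is the lazy-sampling run** `runWith M x (coinAns M F τ x y)`,
`(x, y) = boolUnpair w`. [cite: BookVollmerWagner1996, §3 Prop. 1–2 (p. 373–374)] -/
theorem run_lazySim (F : Finset (List Bool)) (τ : F → Bool) (w : List Bool) (n : ℕ) :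
    (lazySim M).run (lazyOracle F τ) n w =
      runWith M (boolUnpair w).1 (coinAns M F τ (boolUnpair w).1 (boolUnpair w).2) n [] :=
  runAux_lazySim M F τ w n [] (by simp) (by simp)

/-- **The queries of the simulator are short**: within `m` rounds in total, every query record
has length `≤ 2|w| + K + 6 + 12 m + 4 m K` when the queries of `M` have length `≤ K` (the record
holds `w`, the doubled code of an echo transcript of `< m` items of length `≤ K + 1`, and a query). [folklore] -/
theorem length_query_lazySim (F : Finset (List Bool)) (τ : F → Bool) (w : List Bool) {K m : ℕ}
    (hcap : ∀ (as : List (List Bool)) (u : List Bool), M.step (fstF w) as = Sum.inl u → u.length ≤ K) :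
    ∀ (n : ℕ) (as : List (List Bool)), (∀ a ∈ as, ∃ c : Bool, a = [c]) →
      (∀ i < as.length, ∃ u, queryAt M (fstF w) as i = some u) → as.length + n ≤ m →
      ∀ v ∈ (lazySim M).queriesAux (lazyOracle F τ) w n (echo M (fstF w) as),
        v.length ≤ 2 * w.length + K + 6 + 12 * m + 4 * m * K
  | 0, _, _, _, _, v, hv => by simp at hv
  | n + 1, as, hbits, hwf, hm, v, hv => by
    unfold queriesAux at hv
    rw [lazySim_step, map_take_one_echo M _ hbits] at hv
    cases hs : M.step (fstF w) as with
    | inr b => rw [hs] at hv; simp at hv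
    | inl u =>
      rw [hs] at hv
      simp only [List.mem_cons] at hv
      rcases hv with rfl | hv
      · -- the size of the query record
        have hu := hcap as u hs
        have hitems : ∀ e ∈ echo M (fstF w) as, e.length ≤ K + 1 := by
          intro e he
          unfold echo at he
          rw [List.mem_map] at he
          obtain ⟨i, hi, rfl⟩ := he
          rw [List.mem_range] at hi
          obtain ⟨u', hu'⟩ := hwf i hi
          have := hcap _ u' (queryAt_eq_some_iff.1 hu')
          simp [hu']; omega
        have hbody : ∀ E : List (List Bool), (∀ e ∈ E, e.length ≤ K + 1) →
            (E.foldr (fun a acc => boolPair a acc) []).length ≤ E.length * (2 * K + 4) := by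
          intro E
          induction E with
          | nil => simp
          | cons e E ih =>
            intro h
            rw [List.foldr_cons, length_boolPair, List.length_cons]
            have h1 := h e (by simp)
            have h2 := ih fun e' he' => h e' (by simp [he'])
            nlinarith
        have hhdr : ∀ k : ℕ, (unaryEncodeNat k).length = k := by
          intro k; induction k with
          | zero => rfl
          | succ k ih => simp [unaryEncodeNat, ih]
        have hlen := hbody _ hitems
        rw [length_echo] at hlen
        have hE : as.length ≤ m := by omega
        show (boolPair w (boolPair ((encodingList Bool).listBool.encode (echo M (fstF w) as)) u)).length ≤ _
        have henc : ((encodingList Bool).listBool.encode (echo M (fstF w) as)).length =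
            2 * as.length + 2 + ((echo M (fstF w) as).foldr (fun a acc => boolPair a acc) []).length := by
          show (boolPair (unaryEncodeNat _) _).length = _
          rw [length_boolPair, hhdr, length_echo]; rfl
        rw [length_boolPair, length_boolPair, henc]
        have : as.length * (2 * K + 4) ≤ m * (2 * K + 4) := Nat.mul_le_mul_right _ hE
        nlinarith
      · rw [lazyOracle_apply, lazyBit_echo M _ F τ _ hwf, ← echo_append_singleton M _ _ hs] at hv
        refine length_query_lazySim F τ w hcap n _ (fun a ha => ?_) (fun i hi => ?_) ?_ v hv
        · rcases List.mem_append.1 ha with h | h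
          · exact hbits a h
          · simp at h; exact ⟨_, h⟩
        · rw [List.length_append, List.length_singleton] at hi
          rcases Nat.lt_succ_iff_lt_or_eq.1 hi with hi | rfl
          · obtain ⟨u', hu'⟩ := hwf i hi
            exact ⟨u', by rw [queryAt_append_of_lt M _ hi.le, hu']⟩
          · exact ⟨u, by unfold queryAt; rw [List.take_left' rfl, hs]⟩
        · simp; omega

/-! ### The clocked simulator decides the lazy-sampling language relative to the lazy oracle -/

/-- The queries of a clocked algorithm (`OracleAlg.clockBy`) are asked within the clock: they are
queries of the underlying algorithm within `t w - |as|` more rounds. [folklore] -/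
theorem queriesAux_clockBy_subset_clock {β : Type} (N : OracleAlg β) (t : List Bool → ℕ) (b₀ : β) (O : Oracle)
    (w : List Bool) : ∀ (n : ℕ) (as : List (List Bool)) (v : List Bool),
      v ∈ (N.clockBy t b₀).queriesAux O w n as → v ∈ N.queriesAux O w (t w - as.length) as
  | 0, _, _, h => by simp at h
  | n + 1, as, v, h => by
    unfold queriesAux at h
    rw [clockBy_step] at h
    by_cases hlt : as.length < t w
    · rw [if_pos hlt] at h
      obtain ⟨k, hk⟩ : ∃ k, t w - as.length = k + 1 := ⟨t w - as.length - 1, by omega⟩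
      rw [hk]
      unfold queriesAux
      cases hs : N.step w as with
      | inr b => rw [hs] at h; simp at h
      | inl y =>
        rw [hs] at h
        simp only [List.mem_cons] at h ⊢
        rcases h with rfl | h
        · exact Or.inl rfl
        · right
          have h' := queriesAux_clockBy_subset_clock N t b₀ O w n _ v h
          have hlen : t w - (as ++ [O y]).length = k := by simp; omega
          rwa [hlen] at h'
    · rw [if_neg hlt] at h; simp at h

/-- **The clocked simulator**, its round budget `q(|x|)` read off the first component `x` of the
input (`OracleAlg.clockFst`). [cite: AroraBarak2009, §3.4 with §1.4.1 (clocked simulation)] -/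
noncomputable def lazySimC (q : Polynomial ℕ) : OracleAlg Bool := (lazySim M).clockFst q false

/-- **The clocked simulator is polynomial time** (`isPolyTime_trimAnswers`, `isPolyTime_comap`,
`isPolyTime_mapQuery`, `isPolyTime_clockFst`). [cite: AroraBarak2009, §3.4, §1.3] -/
theorem isPolyTime_lazySimC {M : OracleAlg Bool} (hM : M.IsPolyTime encodingBoolBool) (q : Polynomial ℕ) :
    (lazySimC M q).IsPolyTime encodingBoolBool :=
  isPolyTime_clockFst (eb := encodingBoolBool)
    (isPolyTime_mapQuery (eb := encodingBoolBool)
      (isPolyTime_comap (eb := encodingBoolBool) (isPolyTime_trimAnswers hM) fstF_mem_FP)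
      (PolyTimeComputable.id _)) q false

/-- **The lazy-sampling language**: the words `w`, `(x, y) = boolUnpair w`, on which the
lazy-sampling run of `M` on `x` with coins `y` accepts within `q(|x|)` rounds. [cite: BookVollmerWagner1996, §3 Prop. 1–2 (p. 373–374)] -/
def lazyLang (F : Finset (List Bool)) (τ : F → Bool) (q : Polynomial ℕ) : Language Bool :=
  {w | runWith M (boolUnpair w).1 (coinAns M F τ (boolUnpair w).1 (boolUnpair w).2)
    (q.eval (boolUnpair w).1.length) [] = some true}

/-- The round-and-query polynomial of the clocked simulator. [folklore] -/
noncomputable def simPoly (c q : Polynomial ℕ) : Polynomial ℕ :=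
  2 * Polynomial.X + c + 12 * q + 4 * q * c + q + Polynomial.C 7

/-- Value of `simPoly`. [folklore] -/
theorem simPoly_eval (c q : Polynomial ℕ) (n : ℕ) :
    (simPoly c q).eval n = 2 * n + c.eval n + 12 * q.eval n + 4 * q.eval n * c.eval n + q.eval n + 7 := by
  simp [simPoly]

/-- **The lazy-sampling language is in `P` relative to the lazy oracle** (machine `lazySimC`,
polynomial `simPoly c q`). [cite: BookVollmerWagner1996, §3 Prop. 1–2 (p. 373–374)] -/
theorem lazyLang_mem_PRel {M : OracleAlg Bool} (hM : M.IsPolyTime encodingBoolBool) (c : Polynomial ℕ)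
    (hcap : ∀ (x : List Bool) (as : List (List Bool)) (u : List Bool),
      M.step x as = Sum.inl u → u.length ≤ c.eval x.length)
    (F : Finset (List Bool)) (τ : F → Bool) (q : Polynomial ℕ) :
    lazyLang M F τ q ∈ PRel (lazyOracle F τ) := by
  refine ⟨lazySimC M q, isPolyTime_lazySimC hM q, simPoly c q, fun w => ?_⟩
  set x := (boolUnpair w).1 with hx
  have hxw : x.length ≤ w.length := length_boolUnpair_fst_le w
  have hq : q.eval x.length ≤ q.eval w.length := TM2Iter.eval_mono q hxw
  have hc : c.eval x.length ≤ c.eval w.length := TM2Iter.eval_mono c hxw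
  have hfuel : q.eval (boolUnpair w).1.length < (simPoly c q).eval w.length := by
    rw [simPoly_eval, ← hx]; omega
  constructor
  · rw [lazySimC, clockFst, run_clockBy _ _ _ _ _ hfuel, run_lazySim]
    congr 1
    unfold lazyLang Set.boolIndicator
    simp only [Set.mem_setOf_eq, ← hx]
    cases runWith M x (coinAns M F τ x (boolUnpair w).2) (q.eval x.length) [] with
    | none => simp
    | some b => cases b <;> simp
  · intro v hv
    have hv' := queriesAux_clockBy_subset_clock (lazySim M) _ false (lazyOracle F τ) w _ [] v hv
    simp only [List.length_nil, Nat.sub_zero] at hv'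
    have hb := length_query_lazySim M F τ w (K := c.eval x.length) (m := q.eval x.length)
      (fun as u h => hcap _ as u h) (q.eval x.length) [] (by simp) (by simp) (by simp) v hv'
    rw [simPoly_eval]
    have : 4 * q.eval x.length * c.eval x.length ≤ 4 * q.eval w.length * c.eval w.length :=
      Nat.mul_le_mul (Nat.mul_le_mul_left 4 hq) hc
    omega

/-- `FP ⊆ FP^O` by query-free algorithms (the one-liner `FP_subset_FPRel` of
`QuantumComplexity/BosonSamplingMainTheorem.lean`, copied to keep this file's imports inside the
complexity core; refactor: hoist next to `P_subset_PRel_holds` in `OracleProofs.lean`). [folklore] -/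
theorem FP_subset_FPRel_core (O : Oracle) : FP ⊆ FPRel O := by
  intro f hf
  refine ⟨OracleAlg.ofFun f, OracleAlg.isPolyTime_ofFun_holds hf, 1, fun x => ⟨?_, ?_⟩⟩
  · rw [Polynomial.eval_one]
    rfl
  · simp

/-- **The lazy-sampling language is in `P`**: `P^{lazyOracle} ⊆ P^{FP^∅} ⊆ P^∅ = P`. [cite: BookVollmerWagner1996, §4 Thm. 3 and (1) (p. 374–375)] -/
theorem lazyLang_mem_P {M : OracleAlg Bool} (hM : M.IsPolyTime encodingBoolBool) (c : Polynomial ℕ)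
    (hcap : ∀ (x : List Bool) (as : List (List Bool)) (u : List Bool),
      M.step x as = Sum.inl u → u.length ≤ c.eval x.length)
    (F : Finset (List Bool)) (τ : F → Bool) (q : Polynomial ℕ) :
    lazyLang M F τ q ∈ Classes.P := by
  have h1 := lazyLang_mem_PRel hM c hcap F τ q
  have h2 : lazyOracle F τ ∈ FPRel Oracle.empty := FP_subset_FPRel_core _ (lazyOracle_mem_FP F τ)
  have h3 := PRel_subset_PRel_of_mem_FPRel h2 h1
  have h4 := PRel_empty_holds
  unfold PRel_empty at h4
  rwa [h4] at h3

end OracleAlg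

end Literature.Computability.Complexity
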